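/-
COR-CM (cells pub-hodgecm / pub-hodgecm2, stage 2 of the Hodge ladder) — TRANSPOSITION item (vi), S-LANE CARRIERS-PLAN §5 (C′) GUARD / red-team WATCH W3
(TGTBT D20–D24): the μ-ATTACHMENT of the ω-side splitting family of the S2 END displays, CITED BY NAME FROM THE TREE instead of asserted in a docstring.
The plug `Transposition/Item6OmegaMuSplitting.lean` (p321268; mc-theta-3's bytes, own-htheta filer) feeds the displays' binder `s` with
`OmegaMuSplitting.sMu F ι₁ V Φ a := chiSplittingLine … (chiMu F ι₁ Φ) …` — the [GR91, Prop. 3.1.1] compatible continuous splitting obtained by UNDOUBLING a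
`χ_μ`-normalised doubled Weil representation (`Liu2021/Def411WeilCarriersDoubling.lean` p319194), `χ_μ := toHeckeCharacter (μ(Φ, ι₁))`.  mc-theta-3's (α) packet
— (α-0) `UnitaryGroupDoubledSiegelSplitCharacters` p321399, (α-1) `GelbartRogawski1991/DoubledWeilRepresentationUniqueness` p321792, (α-2)
`Liu2021/Def411WeilCarriersDoublingUnique` p322029 (bytes by s2crux-idea-2 / mc-theta-3) — proves IN THE TREE that the χ-normalised doubled Weil representation is
UNIQUE ([GR91] §3.1 p. 455 L1–3 / Remark p. 457; [Kudla96] I §6 Lemma 6.3; [HKS96] §1 (1.14)–(1.15)), hence that `chiSplittingLine χ` does not depend on the choice.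
THIS FILE is the ONE-LINE instantiation at `χ := χ_μ` in the DISPLAYS' OWN VOCABULARY: for every face datum and every `χ_μ`-normalised doubled Weil representation
`sD` of the line datum `(diag V.diagEntries, ⟨T_W a⟩)`, the displayed splitting `sMu F ι₁ V Φ a` IS the transport of `undoubleHom sD` — so the re-cut displays
(`…RestOnePlugged.lean` and successors) can cite the μ-attachment BY NAME (TGTBT D24.3 item 2: «a display that cites it BY NAME from a tree theorem is clean»).
What this does NOT do: identify the undoubled splitting with Liu's PRINTED `ι_μ` of App. D Step 2 (l. 5219) beyond what [HKS96 §1 (1.14)–(1.15)] says in print —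
that sentence stays a citation, not a theorem (there is no second formalisation of `ι_μ` in the tree to compare with).
Seat prover-pub-hodgecm-own-htheta-g5-0 (own-htheta gen 5, S2-CRUX owner; rule-(1) blanket `Transposition/Item6*`).  ONE theorem; no definition, no instance,
no named fact, no `variable`; nothing landed is edited.  HC_CM is NOT proved; S2 is NOT closed; this discharges no displayed hypothesis — it upgrades the
class of the displayed datum `s := sMu` from «χ_μ-attached by construction (docstring)» to «χ_μ-attached and choice-free (tree theorem, by name)».
-/
import Summits.HodgeConjecture.CorCM.B01.Transposition.Item6OmegaMuSplitting
import Literature.NumberTheory.Automorphic.Liu2021.Def411WeilCarriersDoublingUnique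
import HarnessLib

/-!
# The displayed splitting `sMu` is the undoubling of ANY `χ_μ`-normalised doubled Weil representation (W3 / (α), by name)

* `OmegaMuSplitting.sMu_eq_splittingCongr_undoubleHom` — for `h : IsDoubledWeilRep F finProdFinEquiv V.diagEntries … (lineW F (TW F⁺ a)) … (chiMu F ι₁ Φ) sD`:
  `sMu F ι₁ V Φ a = splittingCongr … (undoubleHom … sD h.proj_eq)` — (α-2)'s `chiSplittingLine_eq_splittingCongr_undoubleHom` at `χ := chiMu F ι₁ Φ`,
  through the `rfl`-unfolding of `sMu`.
HC_CM is NOT proved.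

References: S. Gelbart, J. Rogawski, *L-functions and Fourier–Jacobi coefficients for the unitary group U(3)*, Invent. Math. 105 (1991), §3.1 Prop. 3.1.1
p. 455 L1–3, Remark p. 457; M. Harris, S. Kudla, W. Sweet, *Theta dichotomy for unitary groups*, J. AMS 9 (1996), §1 (1.14)–(1.15), Cor. A.3; S. Kudla,
*Notes on the local theta correspondence* (1996), Chap. I §6 Lemma 6.3; Y. Liu, arXiv:2102.11518, App. D §D.1 Step 2 (l. 5219).
-/

set_option autoImplicit false

noncomputable section

open scoped Classical
open scoped Matrix Kronecker TensorProduct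
open NumberField IsDedekindDomain
open Literature.RepresentationTheory.HeisenbergGroup
open Literature.NumberTheory.Weil1964

namespace Summit.HodgeConjecture.CorCM.Transposition.OmegaMuSplitting

open Literature.AlgebraicGeometry.Motives (CMType)
open Literature.NumberTheory.Automorphic
open Literature.NumberTheory.Automorphic.IdeleClassGroup
open Literature.NumberTheory.GaloisRepresentations
open Literature.RepresentationTheory.HarrisKudlaSweet1996
open Literature.RepresentationTheory.Liu2021
open Literature.NumberTheory.GelbartRogawski1991
open Literature.NumberTheory.GelbartRogawski1991.UnitaryDualPair
open Literature.NumberTheory.GelbartRogawski1991.GRConstruction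
open Literature.NumberTheory.Automorphic.Liu2021.Def411WeilCarriersDoubling
open Literature.NumberTheory.Automorphic.Liu2021.Def411WeilCarriers (TW JW JW_eq isSymm_TW isUnit_det_TW)

set_option maxHeartbeats 4000000 in
-- (the statement mentions the `splittingDatum` telescope of `chiSplittingLine`'s type; same budget as the plug's `sMu`)
/-- **The displayed splitting is choice-free and `χ_μ`-attached, BY NAME.**  For a face datum `(F, ι₁, V, Φ)`, a unit `a` of `F⁺` (the hermitian line
`⟨T_W a⟩`) and ANY `χ_μ`-normalised doubled Weil representation `sD` of the line datum (`IsDoubledWeilRep … (chiMu F ι₁ Φ) sD`, [GR91] §3.2 / [HKS96] §1), the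
splitting `sMu F ι₁ V Φ a` fed to the S2 END displays' binder `s` EQUALS the transport along the diagonal frame of the undoubling `undoubleHom sD` — an instance
of (α-2)'s `chiSplittingLine_eq_splittingCongr_undoubleHom` ([GR91] §3.1 p. 455 L1–3: the χ-normalised splitting is unique).  Hence the oscillator the displays
feed to [Liu2021] Thm. 4.18 is THE χ_μ-oscillator, independent of the `Classical.choose` inside `doubledWeilRep`.
[cite: GelbartRogawski1991, §3.1 Prop. 3.1.1 p. 455 L1–3 and §3.2 Remark p. 457] [cite: HarrisKudlaSweet1996, §1 (1.14)–(1.15)] -/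
theorem sMu_eq_splittingCongr_undoubleHom (F : CMField) (ι₁ : F →+* ℂ) (V : HermSpace3 F ι₁) (Φ : CMType F) (a : (↥(maximalRealSubfield F))ˣ)
    {sD : HA F finProdFinEquiv V.diagEntries V.complexConj_diagEntries (lineW F (TW ↥(maximalRealSubfield F) a))
        (complexConj_lineW F (TW ↥(maximalRealSubfield F) a)) →*
      MpD F finProdFinEquiv V.diagEntries V.complexConj_diagEntries (lineW F (TW ↥(maximalRealSubfield F) a))
        (complexConj_lineW F (TW ↥(maximalRealSubfield F) a))}
    (h : IsDoubledWeilRep F finProdFinEquiv V.diagEntries V.complexConj_diagEntries V.diagEntries_ne_zero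
      (lineW F (TW ↥(maximalRealSubfield F) a)) (complexConj_lineW F (TW ↥(maximalRealSubfield F) a))
      (lineW_ne_zero F (TW ↥(maximalRealSubfield F) a) (isUnit_det_TW ↥(maximalRealSubfield F) a)) (chiMu F ι₁ Φ) sD) :
    sMu F ι₁ V Φ a =
      splittingCongr (Fp F) F (IsCMField.complexConj F) 3 1 finProdFinEquiv (Matrix.diagonal V.diagEntries)
        (realDiagonal_lineW F (TW ↥(maximalRealSubfield F) a)) (diagonal_lineW F (TW ↥(maximalRealSubfield F) a) (JW_eq ↥(maximalRealSubfield F) F a))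
        (undoubleHom F finProdFinEquiv V.diagEntries V.complexConj_diagEntries V.diagEntries_ne_zero
          (lineW F (TW ↥(maximalRealSubfield F) a)) (complexConj_lineW F (TW ↥(maximalRealSubfield F) a))
          (lineW_ne_zero F (TW ↥(maximalRealSubfield F) a) (isUnit_det_TW ↥(maximalRealSubfield F) a)) sD h.proj_eq) :=
  chiSplittingLine_eq_splittingCongr_undoubleHom F finProdFinEquiv V.diagEntries V.complexConj_diagEntries V.diagEntries_ne_zero
    (chiMu F ι₁ Φ) (chiMu_isUnitary F ι₁ Φ) (chiMu_isSplittingChar F ι₁ Φ) (TW ↥(maximalRealSubfield F) a)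
    (isUnit_det_TW ↥(maximalRealSubfield F) a) (JW ↥(maximalRealSubfield F) F a) (JW_eq ↥(maximalRealSubfield F) F a) h

end Summit.HodgeConjecture.CorCM.Transposition.OmegaMuSplitting

end
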